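import Summits.BirchSwinnertonDyer.Rank1Residual.Partition.EisensteinKernelCharacter
import HarnessLib

/-!
# The KERNEL DISCRIMINANT of a quadratic rational line `Φ ≤ E[p]` — in particular of every rational
# `3`-isogeny: a squarefree integer `D` with `Γ_ℚ` acting on `Φ` through `χ_D`; parity = `sign D`

HONEST FRAMING (cell `b2b-bsdres-*`, verbatim): the goal of the cell is to DELETE the
COMBINATION-SHAPED residual classes for ALL analytic-rank ≤ 1 curves over ℚ — "full BSD formula
for every rank ≤ 1 curve in class C" assembled STRICTLY from published theorems — so that the
rank-≤1 remainder becomes exactly the CONSTRUCTION-SHAPED classes, which are TYPED (missing-input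
Props), NOT attempted; this is not "finishing BSD". Off-peak literature typer `b2b-bsdres-lit-cgls`
(CGLS22 / GV00, the reducible = Eisenstein column), session 11: an ELEMENTARY REDUCTION of the
Eisenstein column at `p = 3` (classes X1@3, X2@3 = 95 % of the reducible census cells), theorems
only — no definition, no named fact, nothing booked, no label changed.

This is file 2 of 3 (`EisensteinKernelCharacter` → `EisensteinKernelDiscriminant` →
`EisensteinKernelDiscriminantType`). A rational line `Φ ≤ E[p]` (`Rank1Residual.IsRationalLine`: a
`Γ_ℚ`-stable subgroup of order `p`, the kernel of a rational `p`-isogeny) is *quadratic* when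
every `σ ∈ Γ_ℚ` acts on it by `±1` — AUTOMATIC AT `p = 3` (`isQuadratic_three`: `Aut(ℤ/3) = {±1}`).
Content (all [folklore]; `p` odd):

* `exists_kernelDisc` — **existence**: for a quadratic rational line there is a SQUAREFREE INTEGER
  `D ≠ 0` with `(∀ P ∈ Φ, σP = P) ↔ σ√D = √D` for every `σ` (property `hχ` below); `D` is unique
  up to this normalisation (`kernelDisc_eq_mul_sq`); negators: `(∀ P ∈ Φ, σP = −P) ↔ σ√D = −√D`
  (`forall_smul_eq_neg_iff`);
* `exists_coord_of_mem` — **explicit form at ANY non-zero kernel point** `P = (x, y) ∈ Φ`: `x = x₀`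
  is RATIONAL and `D · s² = 4x₀³ + b₂x₀² + 2b₄x₀ + b₆ (= ψ₂(x₀, y)²)` for some `s ∈ ℚˣ` — so `D` is
  the squarefree part of `4x₀³ + b₂x₀² + 2b₄x₀ + b₆` at the rational root `x₀` of the kernel
  polynomial (the classical criterion "rational `3`-isogeny with kernel abscissa `x₀`; rational
  `3`-torsion iff moreover `4x₀³ + b₂x₀² + 2b₄x₀ + b₆ ∈ ℚ²`" is the case `D = 1`);
* `lineEven_iff_pos` / `lineOdd_iff_neg` — **parity**: `Φ` is even (complex conjugation fixes it)
  iff `D > 0`, odd iff `D < 0` (x1a's `smul_geomSqrt_eq_(neg_)of_isComplexConjugation(_of_pos)`).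

File 3 adds: unramified at `p` iff `p ∤ D` (Kummer), the Greenberg–Vatsal type of X1@3 / X2@3
pairs from `(0 < D ↔ 3 ∣ D)`, and a rational `p`-torsion point on every model of `E^{(D)}`.

References: J. H. Silverman, *AEC*, GTM 106 (2009), III.§1, VIII.§1, X.5.4 [SilvermanAEC2009];
R. Greenberg, V. Vatsal, Invent. Math. 142 (2000) 17–63, introduction (parity types of a rational
`p`-isogeny) [GreenbergVatsal2000]; HOME/b2b-bsdres-lit-cgls/CGLS-GV-TYPING.md §18.
-/

set_option autoImplicit false

noncomputable section

open scoped Classical NumberField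

open WeierstrassCurve Literature.NumberTheory.EllipticCurves
  Literature.NumberTheory.EllipticCurves.Rank1Residual Field IsDedekindDomain

namespace Summit.BirchSwinnertonDyer.Rank1Residual

namespace KernelDisc

variable {W : WeierstrassCurve ℚ} {p : ℕ} [Fact p.Prime]

/-! ### §3. The kernel discriminant of a quadratic rational line -/

variable {Φ : AddSubgroup (geomTorsion W (p : ℤ))}

/-- Points of a rational line are killed by `p`. [folklore] -/
theorem zsmul_eq_zero_of_mem (hΦ : IsRationalLine W p Φ) {P : geomTorsion W (p : ℤ)} (hP : P ∈ Φ) :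
    (p : ℤ) • P = 0 := by
  have h : Nat.card Φ • (⟨P, hP⟩ : Φ) = 0 := card_nsmul_eq_zero'
  rw [hΦ.1] at h
  have h' := congrArg Subtype.val h
  rw [← natCast_zsmul, AddSubgroupClass.coe_zsmul] at h'
  exact h'

/-- On a line of odd prime order a non-zero point is not `2`-torsion. [folklore] -/
theorem two_smul_ne_zero (hΦ : IsRationalLine W p Φ) (hp2 : p ≠ 2) {P : geomTorsion W (p : ℤ)}
    (hP : P ∈ Φ) (hP0 : P ≠ 0) : (2 : ℕ) • P ≠ 0 := by
  have hp : p.Prime := Fact.out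
  intro h
  have hpP : (p : ℤ) • P = 0 := zsmul_eq_zero_of_mem hΦ hP
  have hord : addOrderOf P = p := by
    have hdvd : addOrderOf P ∣ p := by
      apply addOrderOf_dvd_of_nsmul_eq_zero; rwa [natCast_zsmul] at hpP
    rcases (Nat.dvd_prime hp).mp hdvd with h1 | h1
    · exact absurd (AddMonoid.addOrderOf_eq_one_iff.mp h1) hP0
    · exact h1
  have h2dvd : p ∣ 2 := hord ▸ addOrderOf_dvd_of_nsmul_eq_zero h
  have := Nat.le_of_dvd two_pos h2dvd
  have := hp.two_le
  omega

/-- The same for the underlying geometric point. [folklore] -/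
theorem two_smul_coe_ne_zero (hΦ : IsRationalLine W p Φ) (hp2 : p ≠ 2) {P : geomTorsion W (p : ℤ)}
    (hP : P ∈ Φ) (hP0 : P ≠ 0) : (2 : ℕ) • (P : W.geomPoints) ≠ 0 := by
  intro h
  apply two_smul_ne_zero hΦ hp2 hP hP0
  apply Subtype.ext
  rw [AddSubmonoidClass.coe_nsmul]
  exact h

/-- A non-zero point of a rational line generates it. [folklore] -/
theorem eq_zmultiples_of_mem (hΦ : IsRationalLine W p Φ) {P : geomTorsion W (p : ℤ)} (hP : P ∈ Φ)
    (hP0 : P ≠ 0) : Φ = AddSubgroup.zmultiples P := by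
  have hp : p.Prime := Fact.out
  have hpP : (p : ℤ) • P = 0 := zsmul_eq_zero_of_mem hΦ hP
  have hord : addOrderOf P = p := by
    have hdvd : addOrderOf P ∣ p := by
      apply addOrderOf_dvd_of_nsmul_eq_zero; rwa [natCast_zsmul] at hpP
    rcases (Nat.dvd_prime hp).mp hdvd with h1 | h1
    · exact absurd (AddMonoid.addOrderOf_eq_one_iff.mp h1) hP0
    · exact h1
  haveI : Finite Φ := Nat.finite_of_card_ne_zero (by rw [hΦ.1]; exact hp.ne_zero)
  symm
  apply AddSubgroup.eq_of_le_of_card_ge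
  · exact (AddSubgroup.zmultiples_le_of_mem hP)
  · rw [hΦ.1, Nat.card_zmultiples, hord]

/-- A rational line has a non-zero point. [folklore] -/
theorem exists_ne_zero_mem (hΦ : IsRationalLine W p Φ) : ∃ P ∈ Φ, P ≠ 0 := by
  have hp : p.Prime := Fact.out
  by_contra h
  push Not at h
  haveI : Subsingleton Φ := ⟨fun a b ↦ Subtype.ext (by rw [h a a.2, h b b.2])⟩
  have h1 : Nat.card Φ = 1 := Nat.card_of_subsingleton (⟨0, Φ.zero_mem⟩ : Φ)
  rw [hΦ.1] at h1
  exact hp.one_lt.ne' h1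

/-- On a quadratic line, `σ` fixes one non-zero point iff it fixes every point. [folklore] -/
theorem forall_smul_eq_iff_of_mem (hΦ : IsRationalLine W p Φ) {P : geomTorsion W (p : ℤ)}
    (hP : P ∈ Φ) (hP0 : P ≠ 0) (σ : absoluteGaloisGroup ℚ) :
    (∀ Q ∈ Φ, σ • Q = Q) ↔ σ • P = P := by
  refine ⟨fun h ↦ h P hP, fun h Q hQ ↦ ?_⟩
  rw [eq_zmultiples_of_mem hΦ hP hP0] at hQ
  obtain ⟨n, rfl⟩ := AddSubgroup.mem_zmultiples_iff.mp hQ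
  rw [smul_comm, h]

omit [Fact p.Prime] in
/-- The `±1` action on a point of a quadratic line, at the level of geometric points. [folklore] -/
theorem smul_coe_eq_or (hq : ∀ σ : absoluteGaloisGroup ℚ, ∀ P ∈ Φ, σ • P = P ∨ σ • P = -P)
    {P : geomTorsion W (p : ℤ)} (hP : P ∈ Φ) (σ : absoluteGaloisGroup ℚ) :
    σ • (P : W.geomPoints) = P ∨ σ • (P : W.geomPoints) = -(P : W.geomPoints) := by
  rcases hq σ P hP with h | h
  · exact Or.inl (by rw [← AddSubgroup.torsionBy.coe_smul, h])
  · exact Or.inr (by rw [← AddSubgroup.torsionBy.coe_smul, h]; rfl)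

/-- `exists_disc` for a non-zero point of a quadratic rational line, with the character stated on
the line's point (subtype level). [folklore] -/
theorem exists_disc_of_mem (hΦ : IsRationalLine W p Φ) (hp2 : p ≠ 2)
    (hq : ∀ σ : absoluteGaloisGroup ℚ, ∀ P ∈ Φ, σ • P = P ∨ σ • P = -P)
    {P : geomTorsion W (p : ℤ)} (hP : P ∈ Φ) (hP0 : P ≠ 0) :
    ∃ (x₀ : ℚ) (y : (AlgebraicClosure ℚ)) (h : (W.baseChange (AlgebraicClosure ℚ)).toAffine.Nonsingular (algebraMap ℚ (AlgebraicClosure ℚ) x₀) y),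
      (P : W.geomPoints) = Affine.Point.some (algebraMap ℚ (AlgebraicClosure ℚ) x₀) y h ∧
      4 * x₀ ^ 3 + W.b₂ * x₀ ^ 2 + 2 * W.b₄ * x₀ + W.b₆ ≠ 0 ∧
      ∀ σ : absoluteGaloisGroup ℚ, σ • P = P ↔
        σ • geomSqrt (4 * x₀ ^ 3 + W.b₂ * x₀ ^ 2 + 2 * W.b₄ * x₀ + W.b₆) =
          geomSqrt (4 * x₀ ^ 3 + W.b₂ * x₀ ^ 2 + 2 * W.b₄ * x₀ + W.b₆) := by
  obtain ⟨x₀, y, h, hPe, hd0, hχ⟩ :=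
    exists_disc (P : W.geomPoints) (two_smul_coe_ne_zero hΦ hp2 hP hP0) (smul_coe_eq_or hq hP)
  refine ⟨x₀, y, h, hPe, hd0, fun σ ↦ ?_⟩
  rw [← hχ σ]
  constructor
  · intro h1; rw [← AddSubgroup.torsionBy.coe_smul, h1]
  · intro h1; exact Subtype.ext (by rw [AddSubgroup.torsionBy.coe_smul]; exact h1)

/-- **THE KERNEL DISCRIMINANT (existence).** Let `Φ ≤ E[p]` (`p` odd) be a rational line on which
`Γ_ℚ` acts through `±1` (a *quadratic* line — automatic at `p = 3`, `isQuadratic_three`). Then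
there is a SQUAREFREE INTEGER `D ≠ 0` such that `Γ_ℚ` acts on `Φ` through the quadratic character
of `ℚ(√D)`: `σ` fixes `Φ` pointwise iff `σ√D = √D`. (Uniqueness of `D`, the negator form, the
explicit formula through `x`-coordinates, parity, ramification and the twist with a rational
`p`-torsion point follow below from this characterising property `hχ`.) [folklore] -/
theorem exists_kernelDisc (hΦ : IsRationalLine W p Φ) (hp2 : p ≠ 2)
    (hq : ∀ σ : absoluteGaloisGroup ℚ, ∀ P ∈ Φ, σ • P = P ∨ σ • P = -P) :
    ∃ D : ℤ, D ≠ 0 ∧ Squarefree D ∧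
      ∀ σ : absoluteGaloisGroup ℚ, (∀ P ∈ Φ, σ • P = P) ↔ σ • geomSqrt (D : ℚ) = geomSqrt (D : ℚ) := by
  obtain ⟨P₀, hP₀, hP₀0⟩ := exists_ne_zero_mem hΦ
  obtain ⟨x₀, y₀, h₀, -, hd₀, hχ₀⟩ := exists_disc_of_mem hΦ hp2 hq hP₀ hP₀0
  obtain ⟨D, s, hDsq, hD0, hs0, hdD⟩ :=
    exists_squarefree_mul_sq (4 * x₀ ^ 3 + W.b₂ * x₀ ^ 2 + 2 * W.b₄ * x₀ + W.b₆) hd₀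
  have hD0' : (D : ℚ) ≠ 0 := by exact_mod_cast hD0
  refine ⟨D, hD0, hDsq, fun σ ↦ ?_⟩
  rw [forall_smul_eq_iff_of_mem hΦ hP₀ hP₀0 σ, hχ₀ σ]
  exact smul_geomSqrt_iff_of_eq_mul_sq hD0' hs0 hdD σ

/-- **Negators.** With `D` as in `exists_kernelDisc` (property `hχ`): `σ` acts by `−1` on the
quadratic line `Φ` iff `σ√D = −√D`. [folklore] -/
theorem forall_smul_eq_neg_iff (hΦ : IsRationalLine W p Φ) (hp2 : p ≠ 2)
    (hq : ∀ σ : absoluteGaloisGroup ℚ, ∀ P ∈ Φ, σ • P = P ∨ σ • P = -P) {D : ℤ} (hD0 : D ≠ 0)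
    (hχ : ∀ σ : absoluteGaloisGroup ℚ, (∀ P ∈ Φ, σ • P = P) ↔ σ • geomSqrt (D : ℚ) = geomSqrt (D : ℚ))
    (σ : absoluteGaloisGroup ℚ) :
    (∀ P ∈ Φ, σ • P = -P) ↔ σ • geomSqrt (D : ℚ) = -geomSqrt (D : ℚ) := by
  have hD0' : (D : ℚ) ≠ 0 := by exact_mod_cast hD0
  obtain ⟨P₀, hP₀, hP₀0⟩ := exists_ne_zero_mem hΦ
  constructor
  · intro h
    have hne : σ • P₀ ≠ P₀ := by
      intro hfix
      have hnegP : P₀ = -P₀ := hfix.symm.trans (h P₀ hP₀)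
      apply two_smul_ne_zero hΦ hp2 hP₀ hP₀0
      rw [two_smul]
      nth_rewrite 2 [hnegP]
      exact add_neg_cancel P₀
    rcases smul_geomSqrt_eq_or σ (D : ℚ) with h1 | h1
    · exact absurd ((hχ σ).mpr h1 P₀ hP₀) hne
    · exact h1
  · intro h Q hQ
    have hne : ¬ σ • geomSqrt (D : ℚ) = geomSqrt (D : ℚ) := by
      rw [h]; exact (geomSqrt_ne_neg hD0').symm
    have hσP₀ : σ • P₀ = -P₀ :=
      (hq σ P₀ hP₀).resolve_left (fun hfix ↦ hne ((hχ σ).mp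
        ((forall_smul_eq_iff_of_mem hΦ hP₀ hP₀0 σ).mpr hfix)))
    by_cases hQ0 : Q = 0
    · rw [hQ0, smul_zero, neg_zero]
    rw [eq_zmultiples_of_mem hΦ hP₀ hP₀0] at hQ
    obtain ⟨n, rfl⟩ := AddSubgroup.mem_zmultiples_iff.mp hQ
    rw [smul_comm, hσP₀, smul_neg]

/-- **The kernel discriminant through coordinates (any kernel point).** With `D` as in
`exists_kernelDisc`: every non-zero `P = (x, y) ∈ Φ` has a RATIONAL `x`-coordinate `x₀`, and
`D · s² = 4x₀³ + b₂x₀² + 2b₄x₀ + b₆ (= (2y + a₁x₀ + a₃)²)` for some rational `s ≠ 0` — i.e. `D` is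
the squarefree part of `ψ₂²(x₀)` at ANY non-zero kernel point (all give the same square class:
`exists_eq_mul_sq_of_forall_iff`). [folklore] -/
theorem exists_coord_of_mem (hΦ : IsRationalLine W p Φ) (hp2 : p ≠ 2)
    (hq : ∀ σ : absoluteGaloisGroup ℚ, ∀ P ∈ Φ, σ • P = P ∨ σ • P = -P) {D : ℤ} (hD0 : D ≠ 0)
    (hχ : ∀ σ : absoluteGaloisGroup ℚ, (∀ P ∈ Φ, σ • P = P) ↔ σ • geomSqrt (D : ℚ) = geomSqrt (D : ℚ))
    {P : geomTorsion W (p : ℤ)} (hP : P ∈ Φ) (hP0 : P ≠ 0) :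
    ∃ (x₀ s : ℚ) (y : (AlgebraicClosure ℚ)) (h : (W.baseChange (AlgebraicClosure ℚ)).toAffine.Nonsingular (algebraMap ℚ (AlgebraicClosure ℚ) x₀) y),
      (P : W.geomPoints) = Affine.Point.some (algebraMap ℚ (AlgebraicClosure ℚ) x₀) y h ∧ s ≠ 0 ∧
        (D : ℚ) * s ^ 2 = 4 * x₀ ^ 3 + W.b₂ * x₀ ^ 2 + 2 * W.b₄ * x₀ + W.b₆ := by
  obtain ⟨x₁, y₁, h₁, hPe, hd₁, hχ₁⟩ := exists_disc_of_mem hΦ hp2 hq hP hP0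
  have hiff : ∀ σ : absoluteGaloisGroup ℚ,
      σ • geomSqrt (4 * x₁ ^ 3 + W.b₂ * x₁ ^ 2 + 2 * W.b₄ * x₁ + W.b₆) =
        geomSqrt (4 * x₁ ^ 3 + W.b₂ * x₁ ^ 2 + 2 * W.b₄ * x₁ + W.b₆) ↔
      σ • geomSqrt (D : ℚ) = geomSqrt (D : ℚ) := by
    intro σ
    rw [← hχ₁ σ, ← hχ σ]
    exact (forall_smul_eq_iff_of_mem hΦ hP hP0 σ).symm
  obtain ⟨r, hr0, hr⟩ := exists_eq_mul_sq_of_forall_iff hd₁ (by exact_mod_cast hD0) hiff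
  exact ⟨x₁, r, y₁, h₁, hPe, hr0, hr.symm⟩

omit [Fact p.Prime] in
/-- **Uniqueness of the kernel discriminant up to squares**: two integers with the characterising
property `hχ` differ by a non-zero rational square factor (so the SQUAREFREE one is unique up to
this normalisation). [folklore] -/
theorem kernelDisc_eq_mul_sq {D D' : ℤ} (hD0 : D ≠ 0) (hD0' : D' ≠ 0)
    (hχ : ∀ σ : absoluteGaloisGroup ℚ, (∀ P ∈ Φ, σ • P = P) ↔ σ • geomSqrt (D : ℚ) = geomSqrt (D : ℚ))
    (hχ' : ∀ σ : absoluteGaloisGroup ℚ, (∀ P ∈ Φ, σ • P = P) ↔ σ • geomSqrt (D' : ℚ) = geomSqrt (D' : ℚ)) :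
    ∃ r : ℚ, r ≠ 0 ∧ (D : ℚ) = D' * r ^ 2 :=
  exists_eq_mul_sq_of_forall_iff (by exact_mod_cast hD0) (by exact_mod_cast hD0')
    (fun σ ↦ (hχ σ).symm.trans (hχ' σ))

/-- **At `p = 3` every rational line is quadratic**: `Aut(ℤ/3) = {±1}`, so every `σ ∈ Γ_ℚ` acts on
a rational line `Φ ≤ E[3]` by `σP = P` or `σP = −P`. [folklore] -/
theorem isQuadratic_three {W : WeierstrassCurve ℚ} {Φ : AddSubgroup (geomTorsion W ((3 : ℕ) : ℤ))}
    (hΦ : IsRationalLine W 3 Φ) (σ : absoluteGaloisGroup ℚ) :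
    ∀ P ∈ Φ, σ • P = P ∨ σ • P = -P := by
  intro P hP
  by_cases hP0 : P = 0
  · exact Or.inl (by rw [hP0, smul_zero])
  have hmem : σ • P ∈ AddSubgroup.zmultiples P := by
    rw [← eq_zmultiples_of_mem hΦ hP hP0]; exact hΦ.2 σ P hP
  obtain ⟨m, hm⟩ := AddSubgroup.mem_zmultiples_iff.mp hmem
  have h3 : (3 : ℤ) • P = 0 := by exact_mod_cast zsmul_eq_zero_of_mem hΦ hP
  -- reduce `m` modulo `3`
  have hm' : σ • P = (m % 3) • P := by
    rw [← hm]
    conv_lhs => rw [← Int.emod_add_mul_ediv m 3]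
    rw [add_smul, mul_comm, mul_smul, h3, smul_zero, add_zero]
  have hlt : m % 3 < 3 := Int.emod_lt_of_pos m (by norm_num)
  have hge : 0 ≤ m % 3 := Int.emod_nonneg m (by norm_num)
  interval_cases hmod : m % 3
  · -- `σ P = 0`: impossible for a non-zero `P`
    rw [zero_smul] at hm'
    exact absurd (smul_eq_zero_iff_eq σ |>.mp hm') hP0
  · exact Or.inl (by rw [hm', one_smul])
  · right
    rw [hm']
    have : (2 : ℤ) • P + P = 0 := by
      rw [show (2 : ℤ) • P + P = (3 : ℤ) • P by rw [show (3 : ℤ) = 2 + 1 by norm_num, add_smul, one_smul], h3]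
    exact eq_neg_of_add_eq_zero_left this

/-! ### §4. Parity of the line = sign of the kernel discriminant -/

section Parity

variable (hΦ : IsRationalLine W p Φ) (hp2 : p ≠ 2) {D : ℤ} (hD0 : D ≠ 0)
  (hχ : ∀ σ : absoluteGaloisGroup ℚ, (∀ P ∈ Φ, σ • P = P) ↔ σ • geomSqrt (D : ℚ) = geomSqrt (D : ℚ))
  (hχ' : ∀ σ : absoluteGaloisGroup ℚ, (∀ P ∈ Φ, σ • P = -P) ↔ σ • geomSqrt (D : ℚ) = -geomSqrt (D : ℚ))

include hχ in
/-- **Positive kernel discriminant ⇒ the line is EVEN** (complex conjugation fixes `√D`, `D > 0`).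
[folklore] -/
theorem lineEven_of_pos (hD : 0 < D) : LineEven W p Φ := by
  intro c hc P hP
  exact (hχ c).mpr (smul_geomSqrt_eq_of_isComplexConjugation_of_pos (by exact_mod_cast hD) hc) P hP

include hχ' in
/-- **Negative kernel discriminant ⇒ the line is ODD** (complex conjugation negates `√D`, `D < 0`).
[folklore] -/
theorem lineOdd_of_neg (hD : D < 0) : LineOdd W p Φ := by
  intro c hc P hP
  exact (hχ' c).mpr (smul_geomSqrt_eq_neg_of_isComplexConjugation (by exact_mod_cast hD) hc) P hP

include hΦ hp2 hD0 hχ hχ' in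
/-- **The line is even iff `D > 0`.** [folklore] -/
theorem lineEven_iff_pos : LineEven W p Φ ↔ 0 < D := by
  refine ⟨fun he ↦ ?_, lineEven_of_pos hχ⟩
  rcases lt_or_gt_of_ne hD0 with hneg | hpos
  · exact absurd (lineOdd_of_neg hχ' hneg) (fun ho ↦ lineEven_lineOdd_false hp2 hΦ he ho)
  · exact hpos

include hΦ hp2 hD0 hχ hχ' in
/-- **The line is odd iff `D < 0`.** [folklore] -/
theorem lineOdd_iff_neg : LineOdd W p Φ ↔ D < 0 := by
  refine ⟨fun ho ↦ ?_, lineOdd_of_neg hχ'⟩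
  rcases lt_or_gt_of_ne hD0 with hneg | hpos
  · exact hneg
  · exact absurd ho (fun ho ↦ lineEven_lineOdd_false hp2 hΦ (lineEven_of_pos hχ hpos) ho)

end Parity

end KernelDisc

end Summit.BirchSwinnertonDyer.Rank1Residual

end
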